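import Summits.Ventures.PercRepro.C041TriDomGlueSideS

/-!
# ROW C-041 — GLUING AT A CUT VERTEX, III′: THE FIBRES OVER THE INSIDE PART, ON ANY BASE STATUS
(p6, gen 45; P6-TWOEXIT-LEAN.md §53 ADDENDUM 16 — the status-general form of the fibre lemmas of
`C041TriDomGlueClasses`, for the induction over cut vertices)

The types `tDinS` / `tRinS` / `tBinS` / `tNinS` of an inside part under `stInS st v z`, and the split of the crossed
classes and of `(⊤, ⊥)` of a base status `st` along the cut (`cycCrossedS_merge_iff`, `topBotS_merge_iff`).
-/

namespace PercRepro

namespace ZoneZ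

namespace MultiExit

open ZoneData Finset

variable {V₁ E₁ U₁ U₂ : Type} (Z₁ : ZoneData V₁ E₁ U₁ U₂) (st : E₁ → EStat) (x y z : V₁)

/-! ## The fibres over the inside part -/

variable (v : V₁)

/-- The inside part is of type `N`: `v, z` connected in neither colour on the `z`-side. -/
def tNinS (i : E₁ → Bool) : Prop := ¬ RdS Z₁ (stInS Z₁ st v z) i v z ∧ ¬ MgS Z₁ (stInS Z₁ st v z) i v z


/-- The inside part is of type `D`: `v, z` connected in both colours on the `z`-side. -/
def tDinS (i : E₁ → Bool) : Prop := RdS Z₁ (stInS Z₁ st v z) i v z ∧ MgS Z₁ (stInS Z₁ st v z) i v z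

/-- The inside part is of type `R`: `v, z` red-connected only. -/
def tRinS (i : E₁ → Bool) : Prop := RdS Z₁ (stInS Z₁ st v z) i v z ∧ ¬ MgS Z₁ (stInS Z₁ st v z) i v z

/-- The inside part is of type `B`: `v, z` blue-connected only. -/
def tBinS (i : E₁ → Bool) : Prop := ¬ RdS Z₁ (stInS Z₁ st v z) i v z ∧ MgS Z₁ (stInS Z₁ st v z) i v z

section Fibres

open Classical in
/-- **THE CROSSED FIBRES**: a merged colouring is crossed according to the type of its inside part. -/
theorem cycCrossedS_merge_iff (hz : z ≠ v) (hx : x ∉ side Z₁ st v z)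
    (hy : y ∉ side Z₁ st v z) (o i : E₁ → Bool) :
    CycCrossedS Z₁ x y z st (merge (InCS Z₁ st v z) o i) ↔
      (tDinS Z₁ st z v i ∧ CycCrossedS Z₁ x y v (stOutS Z₁ st v z) o) ∨
        (tRinS Z₁ st z v i ∧ SibC₃ Z₁ x y v (stOutS Z₁ st v z) o) ∨
        (tBinS Z₁ st z v i ∧ SibC₁ Z₁ x y v (stOutS Z₁ st v z) o) := by
  have hzC : z ∈ side Z₁ st v z := mem_reach_self _ _
  have hv : v ∉ side Z₁ st v z := v_not_mem_sideS Z₁ st v z hz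
  rw [cycCrossedS_iff, cycCrossedS_iff]
  unfold SibC₁ SibC₃ tDinS tRinS tBinS
  rw [RdS_st_iff_out Z₁ st v z hz _ hx hy, RdS_st_iff_through Z₁ st v z hz _ hx hzC,
    RdS_st_iff_through Z₁ st v z hz _ hy hzC, MgS_st_iff_out Z₁ st v z hz _ hx hy,
    MgS_st_iff_through Z₁ st v z hz _ hx hzC, MgS_st_iff_through Z₁ st v z hz _ hy hzC,
    RdS_stOutS_merge, RdS_stOutS_merge, RdS_stOutS_merge, RdS_stInS_merge, MgS_stOutS_merge, MgS_stOutS_merge,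
    MgS_stOutS_merge, MgS_stInS_merge]
  by_cases hR : RdS Z₁ (stInS Z₁ st v z) i v z <;> by_cases hB : MgS Z₁ (stInS Z₁ st v z) i v z
  all_goals
    simp only [hR, hB, and_true, and_false, not_true_eq_false, not_false_eq_true, true_and, false_and, or_false,
      false_or]
  all_goals tauto

open Classical in
/-- **THE `(⊤, ⊥)` FIBRES**: a merged colouring is `(⊤, ⊥)` according to the type of its inside part. -/
theorem topBotS_merge_iff (hz : z ≠ v) (hx : x ∉ side Z₁ st v z)
    (hy : y ∉ side Z₁ st v z) (o i : E₁ → Bool) :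
    TopBotS Z₁ x y z st (merge (InCS Z₁ st v z) o i) ↔
      (tDinS Z₁ st z v i ∧ TopBotS Z₁ x y v (stOutS Z₁ st v z) o) ∨ (tRinS Z₁ st z v i ∧ SibTop Z₁ x y v (stOutS Z₁ st v z) o) := by
  have hzC : z ∈ side Z₁ st v z := mem_reach_self _ _
  have hv : v ∉ side Z₁ st v z := v_not_mem_sideS Z₁ st v z hz
  rw [topBotS_iff, topBotS_iff]
  unfold SibTop tDinS tRinS
  rw [RdS_st_iff_out Z₁ st v z hz _ hx hy, RdS_st_iff_through Z₁ st v z hz _ hx hzC,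
    RdS_st_iff_through Z₁ st v z hz _ hy hzC, MgS_st_iff_out Z₁ st v z hz _ hx hy,
    MgS_st_iff_through Z₁ st v z hz _ hx hzC, MgS_st_iff_through Z₁ st v z hz _ hy hzC,
    RdS_stOutS_merge, RdS_stOutS_merge, RdS_stOutS_merge, RdS_stInS_merge, MgS_stOutS_merge, MgS_stOutS_merge,
    MgS_stOutS_merge, MgS_stInS_merge]
  by_cases hR : RdS Z₁ (stInS Z₁ st v z) i v z <;> by_cases hB : MgS Z₁ (stInS Z₁ st v z) i v z
  all_goals
    simp only [hR, hB, and_true, and_false, not_true_eq_false, not_false_eq_true, true_and, false_and, or_false,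
      false_or]
  all_goals tauto

end Fibres

end MultiExit

end ZoneZ

end PercRepro
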